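import Literature.NumberTheory.Rogawski1990.DepthZeroTransferHValuesTypeTwo                       -- ★ FILE C (tame, `|2| = 1`): brings ★ F2-H level socket, ★ FILE A, ★ F3-1 bridge, one class, place API
import Literature.NumberTheory.Rogawski1990.UnitaryTwoTypeTwoEdgeCountAffine                     -- ★ (P5f): `ncard_selfDualStable_affineReduction_antidiagTwo_eq_sum_of_unitary` (interior count, Eisenstein centre)
import Literature.NumberTheory.Rogawski1990.UnitStableOrbitalIntegralCyclicFrameAffineCentreBound -- ★ `valuation_det_mul_map_sub_le_of_affine`, `det_mul_map_det_eq_one_of_antidiag` (+ ★ CentreTrace)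
import Literature.NumberTheory.Rogawski1990.UnitStableOrbitalIntegralHSideValueTypeTwoAffine      -- ★ `classOrbitalIntegral_indicator_eq_phiHtwo_of_not_exists_isRoot_affine` (the unit, `ν_H(K_H) = 1`)
import HarnessLib

/-!
# The TYPE-(2) H-side LEVEL-ONE values near the identity WITH THE EISENSTEIN CENTRE (any residue characteristic):
# `Φ^st(γ_H, 1_{K_H(1)}-class fn) = ν_H(K_H) · phiHtwo q (j − 1)` and `Φ^st(γ_H, 1_{K_H}) = ν_H(K_H) · phiHtwo q j`

Topic `NumberTheory/Rogawski1990`; namespace `Literature.NumberTheory.Automorphic.UnitaryGroup`.  THEOREMS ONLY (no definition, no instance, no notation, no named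
fact, no `sorry`).  Cell `pub/hodgecm-mathlib`, crux H413 = `stmt-HodgeConjecture-24833`, half-A line LH4 (road M6 ∕ F5, beyond the F5 head: the H-side input of the
dyadic (P-2) clause, SIG-F5 v2 §3 ∕ §6.3); seat LH4-p01 (g11), census `F0/P3c/LH4/LH4-p01/g11/h2aff/CENSUS-H2AFF.v1.LH4p01g11.md`.  Lane `--kind proof --supports
stmt-HodgeConjecture-24833`.  HONEST LABEL: HC_CM is proved only modulo the 7 printed citations (2 remaining named inputs hLiu418 = stmt-HodgeConjecture-24832,
h413 = stmt-HodgeConjecture-24833) until rung 0 closes; this file is unconditional, count-neutral, and reads NO hypothesis on `|2|`.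

THE DICTIONARY.  ★ FILE C `DepthZeroTransferHValuesTypeTwo` proves `Φ^st(γ_H, f_j) = ν_H(K_H)·phiHtwo q (N − j)` for the level-`ϖ_w^j` class function `f_j` on `K_H`
under `|2|_w = 1`, `|tr² − 4det| = exp(−(2N+1))` (completing the square at the centre `tr∕2`).  Here — exactly as in ★ `UnitStableOrbitalIntegralHSideValueTypeTwoAffine`
for the unit — the centre is an ADMISSIBLE EISENSTEIN CENTRE `(a, f, e′, j)` of `g = (γ₂)_w`: `a ∈ 𝒪_w`, `tr g − 2a = f`, `a² − tr g·a + det g = −e′`, `|f| ≤ |ϖ^(j+1)|`,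
`|e′| = |ϖ^(2j+1)|`; at `v ∤ 2` one takes `a = tr∕2`, `f = 0`, `e′ = (tr² − 4det)∕4`, `j = N`.  Only the level `j = 1` is treated (the level the (P-2) clause reads through
★ `DepthZeroTransferHValuesTypeTwoChi`): for a DEEP `γ_H` (`tr g ≡ 2`, `det g ≡ 1 (mod 𝔪_w)`) the centre satisfies `|a − 1| ≤ |ϖ|` (§1: `(a − 1)² = −e′ + a(tr − 2) − (det − 1)`),
so the level-one token `(1 + ϖ⁻¹(g − 1))Λ ⊆ Λ` of ★ F2-H is the INTERIOR token `(g − a·1)Λ ⊆ ϖΛ` of ★ (P5f) (★ F3-1 `map_levelShift_le_iff_map_sub_smul_one_le` at `s := a`),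
and ★ (P5f) `ncard_selfDualStable_affineReduction_antidiagTwo_eq_sum_of_unitary` counts it: `Σ_(k < j) q_v^k`.  Its weak centring hypothesis
`|g₁₀·σa + σ(g₁₀)·a| ≤ |g₁₀·ϖ^(j+1)|` is DISCHARGED here (§1) from unitarity and admissibility alone: the cyclic-frame relations `det g·σ(g₁₀) = −g₁₀`,
`g₁₀·σ(tr g) + σ(g₁₀)·tr g = 0` (★ `exists_rescaled_cyclicFrame`) give `g₁₀·σa + σ(g₁₀)·a = (g₁₀∕det g)·(det g·σa − a)`, and ★ CentreBound
`valuation_det_mul_map_sub_le_of_affine` bounds the last factor by `|ϖ^(j+1)|`.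

* §1 `valuation_sub_one_le_of_admissible_of_deep` (`|a − 1| ≤ |ϖ|`), `valuation_offDiag_centre_le_of_unitary_admissible` (the weak centring bound, discharged).
* §2 **`ncard_selfDualStable_levelOne_antidiagTwo_eq_sum_of_unitary_admissible`** (pure `L_w` statement),
  **`ncard_selfDualStable_levelOne_antidiagTwo_eq_sum_of_not_exists_isRoot_admissible`** (for `γ_H ∈ H_v`; set literal = ★ F2-H's at `c := ϖ_w`).
* §3 `classOrbitalIntegral_levelOne_eq_sum_of_not_exists_isRoot_affine` (`ν_H(K_H) = 1`), **`stableOrbitalIntegralRel_levelOne_eq_mul_phiHtwo_of_not_exists_isRoot_affine`**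
  (any Haar: `ν_H(K_H) · phiHtwo q (j − 1)`), **`stableOrbitalIntegralRel_indicator_eq_mul_phiHtwo_of_not_exists_isRoot_affine`** (the unit, any Haar: `ν_H(K_H) · phiHtwo q j`).

## References
* [Flicker1998UnitaryFL] Y. Z. Flicker, *Elementary proof of the fundamental lemma for a unitary group*, Canad. J. Math. 50 (1998), §6 p. 95 REMARK, p. 97.
* [Rogawski1990] J. D. Rogawski, *Automorphic Representations of Unitary Groups in Three Variables* (1990), §3.6 pp. 28–31; §4.9 Prop. 4.9.1 (b) p. 55; §4.3 (4.3.1) p. 43.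
* [Kottwitz1988] R. E. Kottwitz, *Tamagawa numbers*, Ann. of Math. 127 (1988), §2.
* [Serre1979] J.-P. Serre, *Local Fields*, GTM 67 (1979), Ch. I §6; Ch. V §2.
-/

set_option autoImplicit false

noncomputable section

open MeasureTheory Measure Set NumberField IsDedekindDomain Matrix Finset ValuativeRel
open scoped ENNReal NNReal ValuativeRel Matrix MatrixGroups

namespace Literature.NumberTheory.Automorphic.UnitaryGroup

open Literature.NumberTheory.Rogawski1990 Literature.NumberTheory.Automorphic

/-! ## §1 Two scalar facts about an admissible Eisenstein centre -/

section Scalar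

variable {F : Type*} [Field F] [ValuativeRel F] {ϖ : F} (hϖ : IsUniformizingElement ϖ)

include hϖ in
/-- **`|a − 1| ≤ |ϖ|` for an admissible centre of a DEEP element**: if `a ∈ 𝒪`, `a² − ta + d = −e′` with `|e′| = |ϖ^(2j+1)|`, and `|t − 2| < 1`, `|d − 1| < 1`,
then `|a − 1| ≤ |ϖ|` — since `(a − 1)² = −e′ + a(t − 2) − (d − 1)` has valuation `< 1`.  (At `v ∤ 2`: `a = t∕2 ≡ 1`; at `v ∣ 2` it is the statement that the
`1`-coordinate of a principal-unit eigenvalue is a principal unit.) [cite: Serre1979, Ch. I §6] [cite: Flicker1998UnitaryFL, §6 p. 97] -/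
theorem valuation_sub_one_le_of_admissible_of_deep {t d a e' : F} {j : ℕ} (haO : a ∈ 𝒪[F])
    (hj : valuation F e' = valuation F (ϖ ^ (2 * j + 1))) (hde : a * a - t * a + d = -e')
    (htr : valuation F (t - 2) < 1) (hdet : valuation F (d - 1) < 1) :
    valuation F (a - 1) ≤ valuation F ϖ := by
  have hϖ1 : valuation F ϖ < 1 := hϖ.valuation_lt_one
  have ha1 : valuation F a ≤ 1 := (Valuation.mem_integer_iff _ _).1 haO
  have hsq : (a - 1) ^ 2 = -e' + a * (t - 2) - (d - 1) := by linear_combination hde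
  have he' : valuation F (-e') < 1 := by
    rw [Valuation.map_neg, hj, map_pow]
    exact pow_lt_one₀ zero_le hϖ1 (by omega)
  have hat : valuation F (a * (t - 2)) < 1 := by
    rw [map_mul]
    calc valuation F a * valuation F (t - 2) ≤ 1 * valuation F (t - 2) := mul_le_mul_left ha1 _
      _ < 1 := by rw [one_mul]; exact htr
  have hlt2 : valuation F ((a - 1) ^ 2) < 1 := by
    rw [hsq]
    exact Valuation.map_sub_lt _ (Valuation.map_add_lt _ he' hat) hdet
  have hO1 : a - 1 ∈ 𝒪[F] := Subring.sub_mem _ haO (Subring.one_mem _)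
  have hle1 : valuation F (a - 1) ≤ 1 := (Valuation.mem_integer_iff _ _).1 hO1
  have hlt : valuation F (a - 1) < 1 := lt_of_le_of_ne hle1 fun h => by
    rw [map_pow, h, one_pow] at hlt2
    exact lt_irrefl _ hlt2
  obtain ⟨y, hy, hyeq⟩ := hϖ.exists_eq_mul hO1 hlt
  rw [hyeq, map_mul]
  calc valuation F ϖ * valuation F y ≤ valuation F ϖ * 1 := mul_le_mul_right ((Valuation.mem_integer_iff _ _).1 hy) _
    _ = valuation F ϖ := mul_one _

variable [IsDiscreteValuationRing 𝒪[F]] (σ : F →+* F) (hσσ : ∀ x, σ (σ x) = x) (hσv : ∀ x, valuation F (σ x) = valuation F x)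

include hϖ hσσ hσv in
/-- **THE WEAK CENTRING BOUND, DISCHARGED** (the `hga′` hypothesis of ★ (P5f) `ncard_selfDualStable_affineReduction_antidiagTwo_eq_sum_of_unitary` from unitarity and
admissibility alone): for `g ∈ GL₂(F)` unitary for `!![0,1;1,0]` with `g₁₀ ≠ 0` and an admissible centre `(a, f, e′, j)` (`tr g − 2a = f`, `a² − tr g·a + det g = −e′`,
`|f| ≤ |ϖ^(j+1)|`, `|e′| = |ϖ^(2j+1)|`): `|g₁₀·σa + σ(g₁₀)·a| ≤ |g₁₀·ϖ^(j+1)|`.  The cyclic-frame relations `det g·σ(g₁₀) = −g₁₀`, `g₁₀·σ(tr g) + σ(g₁₀)·tr g = 0`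
(★ `exists_rescaled_cyclicFrame`) give `det g·(g₁₀·σa + σ(g₁₀)·a) = g₁₀·(det g·σa − a)`, and ★ `valuation_det_mul_map_sub_le_of_affine` bounds `|det g·σa − a| ≤ |ϖ^(j+1)|`.
[cite: Flicker1998UnitaryFL, §6 p. 97] [cite: Rogawski1990, §3.6 pp. 28–31] [cite: Serre1979, Ch. I §6] -/
theorem valuation_offDiag_centre_le_of_unitary_admissible
    (gGL : GL (Fin 2) F) (g : Matrix (Fin 2) (Fin 2) F) (hcoe : (gGL : Matrix (Fin 2) (Fin 2) F) = g)
    (hgU : (g.map σ)ᵀ * (!![0, 1; 1, 0] : Matrix (Fin 2) (Fin 2) F) * g = !![0, 1; 1, 0]) (hg10 : g 1 0 ≠ 0)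
    {a f e' : F} {j : ℕ}
    (hf : valuation F f ≤ valuation F (ϖ ^ (j + 1))) (hj : valuation F e' = valuation F (ϖ ^ (2 * j + 1)))
    (htf : g.trace - 2 * a = f) (hde : a * a - g.trace * a + g.det = -e') :
    valuation F (g 1 0 * σ a + σ (g 1 0) * a) ≤ valuation F (g 1 0 * ϖ ^ (j + 1)) := by
  obtain ⟨-, -, -, hdβ, htr⟩ := exists_rescaled_cyclicFrame σ gGL g hcoe hgU hg10 (a := 1) one_ne_zero (map_one σ)
  have hd0 : g.det ≠ 0 := fun h => hg10 (by
    have h' := hdβ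
    rw [h, zero_mul] at h'
    exact (neg_eq_zero.1 h'.symm))
  have hdv : valuation F g.det = 1 := by
    have h := congrArg (valuation F) hdβ
    rw [map_mul, Valuation.map_neg, hσv] at h
    exact mul_right_cancel₀ ((Valuation.ne_zero_iff _).2 hg10) (h.trans (one_mul _).symm)
  have hσd : g.det * σ g.det = 1 := det_mul_map_det_eq_one_of_antidiag σ hσσ hdβ hg10
  have hdt : g.det * σ g.trace = g.trace := mul_map_trace_eq_trace_of_antidiagTrace σ hdβ hd0 hg10 htr
  have hb := valuation_det_mul_map_sub_le_of_affine hϖ σ hσv hdv hσd hdt hf hj htf hde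
  have key : g.det * (g 1 0 * σ a + σ (g 1 0) * a) = g 1 0 * (g.det * σ a - a) := by linear_combination a * hdβ
  have hv := congrArg (valuation F) key
  rw [map_mul, hdv, one_mul, map_mul] at hv
  rw [hv, map_mul]
  exact mul_le_mul_right hb _

end Scalar

/-! ## §2 The level-one count at the place `w` with the Eisenstein centre -/

section Count

variable (L : Type) [Field L] [NumberField L] [IsCMField L] (v : HeightOneSpectrum (𝓞 ↥(maximalRealSubfield L)))
  (w : PlacesOver L v) (hw : IsCMField.complexConj L • w.1 = w.1)

set_option maxHeartbeats 800000 in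
include hw in
/-- **THE LEVEL-ONE COUNT AT THE PLACE `w` FOR A UNITARY MATRIX WITH AN ADMISSIBLE EISENSTEIN CENTRE** (pure `L_w` statement; NO `|2| = 1`): for `g ∈ GL₂(L_w)`
unitary for `(Φ₂)_w = !![0,1;1,0]`, `χ_g` without root in `L_w`, scalars `(a, f, e′, j)` with `a ∈ 𝒪`, `tr g − 2a = f`, `a² − tr g·a + det g = −e′`, `|f| ≤ |ϖ^(j+1)|`,
`|e′| = |ϖ^(2j+1)|`, and `g` DEEP (`|tr g − 2| < 1`, `|det g − 1| < 1`):
`#{Λ ∈ S((Φ₂)_w, g) : (1 + ϖ⁻¹(g − 1))Λ ⊆ Λ} = Σ_(k < j) q_v^k` — §1 (`|a − 1| ≤ |ϖ|`) + ★ F3-1 `map_levelShift_le_iff_map_sub_smul_one_le` (`i := 1`, `s := a`) turn the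
level-one token into the interior token `(g − a·1)Λ ⊆ ϖΛ`, counted by ★ (P5f) `ncard_selfDualStable_affineReduction_antidiagTwo_eq_sum_of_unitary` whose weak centring
input is §1.  Twin of ★ FILE C `ncard_selfDualStable_level_antidiagTwo_eq_sum_of_unitary` at `j = 1` (`|2| = 1`, centre `tr∕2`, radius `N`).
[cite: Flicker1998UnitaryFL, §6 p. 97] [cite: Rogawski1990, §3.6 pp. 28–31] [cite: Kottwitz1988, §2] -/
theorem ncard_selfDualStable_levelOne_antidiagTwo_eq_sum_of_unitary_admissible (hunr : Algebra.IsUnramifiedIn (𝓞 L) v.asIdeal)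
    (gGL : GL (Fin 2) (w.1.adicCompletion L)) (g : Matrix (Fin 2) (Fin 2) (w.1.adicCompletion L)) (hcoe : (gGL : Matrix (Fin 2) (Fin 2) (w.1.adicCompletion L)) = g)
    (hgU : (g.map (galAdicCompletionMap (L := L) (IsCMField.complexConj L) hw))ᵀ * (!![0, 1; 1, 0] : Matrix (Fin 2) (Fin 2) (w.1.adicCompletion L)) * g = !![0, 1; 1, 0])
    (hirr : ¬ ∃ x : (w.1.adicCompletion L), (g.charpoly).IsRoot x)
    {a f e' : (w.1.adicCompletion L)} (haO : a ∈ 𝒪[(w.1.adicCompletion L)]) {j : ℕ}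
    (hf : valuation (w.1.adicCompletion L) f ≤ valuation (w.1.adicCompletion L) ((toPlace v w (GaloisRepresentations.HeckeCharacter.uniformizer ↥(maximalRealSubfield L) v : v.adicCompletion ↥(maximalRealSubfield L))) ^ (j + 1)))
    (hj : valuation (w.1.adicCompletion L) e' = valuation (w.1.adicCompletion L) ((toPlace v w (GaloisRepresentations.HeckeCharacter.uniformizer ↥(maximalRealSubfield L) v : v.adicCompletion ↥(maximalRealSubfield L))) ^ (2 * j + 1)))
    (htf : g.trace - 2 * a = f) (hde : a * a - g.trace * a + g.det = -e')
    (htr : valuation (w.1.adicCompletion L) (g.trace - 2) < 1) (hdet : valuation (w.1.adicCompletion L) (g.det - 1) < 1) :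
    {Λ : Submodule 𝒪[(w.1.adicCompletion L)] (Fin 2 → (w.1.adicCompletion L)) |
        (∃ g' : GL (Fin 2) (w.1.adicCompletion L), (∃ J' ∈ glInt 2 (w.1.adicCompletion L), (J' : Matrix (Fin 2) (Fin 2) (w.1.adicCompletion L)) =
            formCongr (galAdicCompletionMap (L := L) (IsCMField.complexConj L) hw) g' (placeForm (Matrix.of fun i j : Fin 2 => if i.val + j.val + 1 = 2 then (1 : L) else 0) w.1)) ∧
          Λ = Submodule.span 𝒪[(w.1.adicCompletion L)] (Set.range ((g' : Matrix (Fin 2) (Fin 2) (w.1.adicCompletion L)))ᵀ)) ∧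
        Λ.map ((Matrix.toLin' ((gGL : GL (Fin 2) (w.1.adicCompletion L)) : Matrix (Fin 2) (Fin 2) (w.1.adicCompletion L))).restrictScalars 𝒪[(w.1.adicCompletion L)]) = Λ ∧
        Λ.map ((Matrix.toLin' (1 + ((toPlace v w (GaloisRepresentations.HeckeCharacter.uniformizer ↥(maximalRealSubfield L) v : v.adicCompletion ↥(maximalRealSubfield L))) : (w.1.adicCompletion L))⁻¹ • (((gGL : GL (Fin 2) (w.1.adicCompletion L)) : Matrix (Fin 2) (Fin 2) (w.1.adicCompletion L)) - 1))).restrictScalars 𝒪[(w.1.adicCompletion L)]) ≤ Λ}.ncard =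
      ∑ k ∈ range j, Nat.card (𝓞 ↥(maximalRealSubfield L) ⧸ v.asIdeal) ^ k := by
  classical
  have hc1 : IsCMField.complexConj L ≠ 1 := IsCMField.complexConj_ne_one L
  have hϖv := Liu2021.LemD1IndexedNonVacuityInertCofinite.valued_toPlace_uniformizer_of_isUnramifiedIn L v hunr w
  have hϖ : IsUniformizingElement (toPlace v w (GaloisRepresentations.HeckeCharacter.uniformizer ↥(maximalRealSubfield L) v : v.adicCompletion ↥(maximalRealSubfield L))) := isUniformizingElement_of_v_eq hϖv
  haveI : IsDiscreteValuationRing 𝒪[(w.1.adicCompletion L)] := isDiscreteValuationRing_integer_of_compatible hϖv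
  have hσv : ∀ x, valuation (w.1.adicCompletion L) ((galAdicCompletionMap (L := L) (IsCMField.complexConj L) hw) x) = valuation (w.1.adicCompletion L) x := fun x => valuation_galAdicCompletionMap_eq (IsCMField.complexConj L) v w hw x
  have hσσ : ∀ x, (galAdicCompletionMap (L := L) (IsCMField.complexConj L) hw) ((galAdicCompletionMap (L := L) (IsCMField.complexConj L) hw) x) = x := fun x => galAdicCompletionMap_galAdicCompletionMap_of_smul_eq (IsCMField.complexConj L) w hc1 hw x
  -- `g₁₀ ≠ 0` (else `g₀₀` is a root of `χ_g`)
  have hg10 : g 1 0 ≠ 0 := fun h10 => hirr ⟨g 0 0, by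
    rw [Polynomial.IsRoot, Matrix.charpoly_fin_two, Matrix.trace_fin_two, Matrix.det_fin_two, h10]
    simp; ring⟩
  -- the affine matrix relation (★ (A1)) and the weak centring bound (§1)
  have hk : (g - a • (1 : Matrix (Fin 2) (Fin 2) (w.1.adicCompletion L))) * (g - a • (1 : Matrix (Fin 2) (Fin 2) (w.1.adicCompletion L))) =
      f • (g - a • (1 : Matrix (Fin 2) (Fin 2) (w.1.adicCompletion L))) + e' • (1 : Matrix (Fin 2) (Fin 2) (w.1.adicCompletion L)) := by
    rw [sub_smul_one_mul_self_eq_affine g a, htf, hde, neg_smul, sub_neg_eq_add]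
  have hga' := valuation_offDiag_centre_le_of_unitary_admissible hϖ (galAdicCompletionMap (L := L) (IsCMField.complexConj L) hw) hσσ hσv gGL g hcoe hgU hg10 hf hj htf hde
  -- `|a − 1| ≤ |ϖ|` (§1)
  have ha1 : valuation (w.1.adicCompletion L) (a - 1) ≤ valuation (w.1.adicCompletion L) ((toPlace v w (GaloisRepresentations.HeckeCharacter.uniformizer ↥(maximalRealSubfield L) v : v.adicCompletion ↥(maximalRealSubfield L))) ^ 1) := by
    rw [pow_one]; exact valuation_sub_one_le_of_admissible_of_deep hϖ haO hj hde htr hdet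
  rw [← ncard_selfDualStable_affineReduction_antidiagTwo_eq_sum_of_unitary L v w hw hunr gGL g hcoe hgU hirr haO hf hj hk hga']
  congr 1
  ext Λ
  simp only [Set.mem_setOf_eq]
  constructor
  · rintro ⟨⟨g', hsd, rfl⟩, hst, hlev⟩
    have h := map_levelShift_le_iff_map_sub_smul_one_le hϖ (i := 1) le_rfl gGL g' ha1 hst
    rw [pow_one] at h
    exact ⟨⟨⟨g', hsd, rfl⟩, hst⟩, h.1 hlev⟩
  · rintro ⟨⟨⟨g', hsd, rfl⟩, hst⟩, hred⟩
    have h := map_levelShift_le_iff_map_sub_smul_one_le hϖ (i := 1) le_rfl gGL g' ha1 hst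
    rw [pow_one] at h
    exact ⟨⟨g', hsd, rfl⟩, hst, h.2 hred⟩

omit [IsCMField L] in
/-- `(Φ₂)_w = !![0, 1; 1, 0]` (entries `0, 1` under `algebraMap`). [folklore] -/
private theorem placeForm_antidiagTwo_eq_lvl :
    placeForm (Matrix.of fun i j : Fin 2 => if i.val + j.val + 1 = 2 then (1 : L) else 0) w.1 = (!![0, 1; 1, 0] : Matrix (Fin 2) (Fin 2) (w.1.adicCompletion L)) := by
  ext i j
  fin_cases i <;> fin_cases j <;> simp [placeForm, Matrix.map_apply]

set_option maxHeartbeats 800000 in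
include hw in
/-- **THE LEVEL-ONE COUNT AT THE PLACE `w` FOR A TYPE-(2) ELEMENT WITH AN ADMISSIBLE EISENSTEIN CENTRE** `γ₂ ∈ U(Φ₂)(L⁺_v)` (`hirr` at `w`; scalars `(a, f, e′, j)`;
deepness `|tr(γ₂)_w − 2| < 1`, `|det(γ₂)_w − 1| < 1`; NO `h2`, NO `hint`, NO `N`): `#{Λ ∈ S((Φ₂)_w, (γ₂)_w) : (1 + ϖ_w⁻¹((γ₂)_w − 1))Λ ⊆ Λ} = Σ_(k < j) q_v^k` — the set is
★ F2-H `classOrbitalIntegral_level_prod_eq_ncard_selfDual_level`'s at `c := ϖ_w`. [cite: Flicker1998UnitaryFL, §6 p. 97] [cite: Rogawski1990, §3.6 pp. 28–31] [cite: Kottwitz1988, §2] -/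
theorem ncard_selfDualStable_levelOne_antidiagTwo_eq_sum_of_not_exists_isRoot_admissible (hunr : Algebra.IsUnramifiedIn (𝓞 L) v.asIdeal)
    (γH : (cmDatum L 2 (Matrix.of fun i j : Fin 2 => if i.val + j.val + 1 = 2 then (1 : L) else 0)).Local v × (cmDatum L 1 (Matrix.of fun i j : Fin 1 => if i.val + j.val + 1 = 1 then (1 : L) else 0)).Local v)
    (hirr : ¬ ∃ x : (w.1.adicCompletion L), (((((γH.1.val : GL (Fin 2) (LocalRing L v)) : Matrix (Fin 2) (Fin 2) (LocalRing L v)).map (Pi.evalRingHom (fun w' : PlacesOver L v => w'.1.adicCompletion L) w))).charpoly).IsRoot x)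
    {a f e' : (w.1.adicCompletion L)} (haO : a ∈ 𝒪[(w.1.adicCompletion L)]) {j : ℕ}
    (hf : valuation (w.1.adicCompletion L) f ≤ valuation (w.1.adicCompletion L) ((toPlace v w (GaloisRepresentations.HeckeCharacter.uniformizer ↥(maximalRealSubfield L) v : v.adicCompletion ↥(maximalRealSubfield L))) ^ (j + 1)))
    (hj : valuation (w.1.adicCompletion L) e' = valuation (w.1.adicCompletion L) ((toPlace v w (GaloisRepresentations.HeckeCharacter.uniformizer ↥(maximalRealSubfield L) v : v.adicCompletion ↥(maximalRealSubfield L))) ^ (2 * j + 1)))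
    (htf : ((((γH.1.val : GL (Fin 2) (LocalRing L v)) : Matrix (Fin 2) (Fin 2) (LocalRing L v)).map (Pi.evalRingHom (fun w' : PlacesOver L v => w'.1.adicCompletion L) w))).trace - 2 * a = f)
    (hde : a * a - ((((γH.1.val : GL (Fin 2) (LocalRing L v)) : Matrix (Fin 2) (Fin 2) (LocalRing L v)).map (Pi.evalRingHom (fun w' : PlacesOver L v => w'.1.adicCompletion L) w))).trace * a + ((((γH.1.val : GL (Fin 2) (LocalRing L v)) : Matrix (Fin 2) (Fin 2) (LocalRing L v)).map (Pi.evalRingHom (fun w' : PlacesOver L v => w'.1.adicCompletion L) w))).det = -e')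
    (htr : valuation (w.1.adicCompletion L) (((((γH.1.val : GL (Fin 2) (LocalRing L v)) : Matrix (Fin 2) (Fin 2) (LocalRing L v)).map (Pi.evalRingHom (fun w' : PlacesOver L v => w'.1.adicCompletion L) w))).trace - 2) < 1)
    (hdet : valuation (w.1.adicCompletion L) (((((γH.1.val : GL (Fin 2) (LocalRing L v)) : Matrix (Fin 2) (Fin 2) (LocalRing L v)).map (Pi.evalRingHom (fun w' : PlacesOver L v => w'.1.adicCompletion L) w))).det - 1) < 1) :
    {Λ : Submodule 𝒪[(w.1.adicCompletion L)] (Fin 2 → (w.1.adicCompletion L)) |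
        (∃ g : GL (Fin 2) (w.1.adicCompletion L), (∃ J' ∈ glInt 2 (w.1.adicCompletion L), (J' : Matrix (Fin 2) (Fin 2) (w.1.adicCompletion L)) =
            formCongr (galAdicCompletionMap (L := L) (IsCMField.complexConj L) hw) g (placeForm (Matrix.of fun i j : Fin 2 => if i.val + j.val + 1 = 2 then (1 : L) else 0) w.1)) ∧
          Λ = Submodule.span 𝒪[(w.1.adicCompletion L)] (Set.range ((g : Matrix (Fin 2) (Fin 2) (w.1.adicCompletion L)))ᵀ)) ∧
        Λ.map ((Matrix.toLin' ((((localNonsplitEquiv (IsCMField.complexConj L) (Matrix.of fun i j : Fin 2 => if i.val + j.val + 1 = 2 then (1 : L) else 0) (IsCMField.complexConj_ne_one L) w hw γH.1 : unitaryGroupOfForm (galAdicCompletionMap (L := L) (IsCMField.complexConj L) hw) (placeForm (Matrix.of fun i j : Fin 2 => if i.val + j.val + 1 = 2 then (1 : L) else 0) w.1)) : GL (Fin 2) (w.1.adicCompletion L))) : Matrix (Fin 2) (Fin 2) (w.1.adicCompletion L))).restrictScalars 𝒪[(w.1.adicCompletion L)]) = Λ ∧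
        Λ.map ((Matrix.toLin' (1 + ((toPlace v w (GaloisRepresentations.HeckeCharacter.uniformizer ↥(maximalRealSubfield L) v : v.adicCompletion ↥(maximalRealSubfield L))) : (w.1.adicCompletion L))⁻¹ • (((((localNonsplitEquiv (IsCMField.complexConj L) (Matrix.of fun i j : Fin 2 => if i.val + j.val + 1 = 2 then (1 : L) else 0) (IsCMField.complexConj_ne_one L) w hw γH.1 : unitaryGroupOfForm (galAdicCompletionMap (L := L) (IsCMField.complexConj L) hw) (placeForm (Matrix.of fun i j : Fin 2 => if i.val + j.val + 1 = 2 then (1 : L) else 0) w.1)) : GL (Fin 2) (w.1.adicCompletion L))) : Matrix (Fin 2) (Fin 2) (w.1.adicCompletion L)) - 1))).restrictScalars 𝒪[(w.1.adicCompletion L)]) ≤ Λ}.ncard =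
      ∑ k ∈ range j, Nat.card (𝓞 ↥(maximalRealSubfield L) ⧸ v.asIdeal) ^ k := by
  have hcoe : ((((localNonsplitEquiv (IsCMField.complexConj L) (Matrix.of fun i j : Fin 2 => if i.val + j.val + 1 = 2 then (1 : L) else 0) (IsCMField.complexConj_ne_one L) w hw γH.1 : unitaryGroupOfForm (galAdicCompletionMap (L := L) (IsCMField.complexConj L) hw) (placeForm (Matrix.of fun i j : Fin 2 => if i.val + j.val + 1 = 2 then (1 : L) else 0) w.1)) : GL (Fin 2) (w.1.adicCompletion L))) : Matrix (Fin 2) (Fin 2) (w.1.adicCompletion L)) = (((γH.1.val : GL (Fin 2) (LocalRing L v)) : Matrix (Fin 2) (Fin 2) (LocalRing L v)).map (Pi.evalRingHom (fun w' : PlacesOver L v => w'.1.adicCompletion L) w)) :=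
    coe_localNonsplitEquiv_apply L (Matrix.of fun i j : Fin 2 => if i.val + j.val + 1 = 2 then (1 : L) else 0) v w hw γH.1
  have hgU : (((((γH.1.val : GL (Fin 2) (LocalRing L v)) : Matrix (Fin 2) (Fin 2) (LocalRing L v)).map (Pi.evalRingHom (fun w' : PlacesOver L v => w'.1.adicCompletion L) w))).map (galAdicCompletionMap (L := L) (IsCMField.complexConj L) hw))ᵀ * (!![0, 1; 1, 0] : Matrix (Fin 2) (Fin 2) (w.1.adicCompletion L)) * (((γH.1.val : GL (Fin 2) (LocalRing L v)) : Matrix (Fin 2) (Fin 2) (LocalRing L v)).map (Pi.evalRingHom (fun w' : PlacesOver L v => w'.1.adicCompletion L) w)) = !![0, 1; 1, 0] := by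
    rw [← hcoe, ← placeForm_antidiagTwo_eq_lvl L v w]
    exact (mem_unitaryGroupOfForm_iff (σ := (galAdicCompletionMap (L := L) (IsCMField.complexConj L) hw)) (J := placeForm (Matrix.of fun i j : Fin 2 => if i.val + j.val + 1 = 2 then (1 : L) else 0) w.1) (g := ((localNonsplitEquiv (IsCMField.complexConj L) (Matrix.of fun i j : Fin 2 => if i.val + j.val + 1 = 2 then (1 : L) else 0) (IsCMField.complexConj_ne_one L) w hw γH.1 : unitaryGroupOfForm (galAdicCompletionMap (L := L) (IsCMField.complexConj L) hw) (placeForm (Matrix.of fun i j : Fin 2 => if i.val + j.val + 1 = 2 then (1 : L) else 0) w.1)) : GL (Fin 2) (w.1.adicCompletion L)))).1 ((localNonsplitEquiv (IsCMField.complexConj L) (Matrix.of fun i j : Fin 2 => if i.val + j.val + 1 = 2 then (1 : L) else 0) (IsCMField.complexConj_ne_one L) w hw γH.1 : unitaryGroupOfForm (galAdicCompletionMap (L := L) (IsCMField.complexConj L) hw) (placeForm (Matrix.of fun i j : Fin 2 => if i.val + j.val + 1 = 2 then (1 : L) else 0) w.1))).2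
  exact ncard_selfDualStable_levelOne_antidiagTwo_eq_sum_of_unitary_admissible L v w hw hunr _ _ hcoe hgU hirr haO hf hj htf hde htr hdet

end Count

/-! ## §3 The values: per class (`ν_H(K_H) = 1`) and for any Haar measure -/

section Head

variable (L : Type) [Field L] [NumberField L] [IsCMField L] (v : HeightOneSpectrum (𝓞 ↥(maximalRealSubfield L)))
  (w : PlacesOver L v) (hw : IsCMField.complexConj L • w.1 = w.1)
  [MeasurableSpace ((cmDatum L 2 (Matrix.of fun i j : Fin 2 => if i.val + j.val + 1 = 2 then (1 : L) else 0)).Local v × (cmDatum L 1 (Matrix.of fun i j : Fin 1 => if i.val + j.val + 1 = 1 then (1 : L) else 0)).Local v)] [BorelSpace ((cmDatum L 2 (Matrix.of fun i j : Fin 2 => if i.val + j.val + 1 = 2 then (1 : L) else 0)).Local v × (cmDatum L 1 (Matrix.of fun i j : Fin 1 => if i.val + j.val + 1 = 1 then (1 : L) else 0)).Local v)]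
  [∀ a : (cmDatum L 2 (Matrix.of fun i j : Fin 2 => if i.val + j.val + 1 = 2 then (1 : L) else 0)).Local v × (cmDatum L 1 (Matrix.of fun i j : Fin 1 => if i.val + j.val + 1 = 1 then (1 : L) else 0)).Local v, MeasurableSpace (((cmDatum L 2 (Matrix.of fun i j : Fin 2 => if i.val + j.val + 1 = 2 then (1 : L) else 0)).Local v × (cmDatum L 1 (Matrix.of fun i j : Fin 1 => if i.val + j.val + 1 = 1 then (1 : L) else 0)).Local v) ⧸ Subgroup.centralizer ({a} : Set ((cmDatum L 2 (Matrix.of fun i j : Fin 2 => if i.val + j.val + 1 = 2 then (1 : L) else 0)).Local v × (cmDatum L 1 (Matrix.of fun i j : Fin 1 => if i.val + j.val + 1 = 1 then (1 : L) else 0)).Local v)))]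
  [∀ a : (cmDatum L 2 (Matrix.of fun i j : Fin 2 => if i.val + j.val + 1 = 2 then (1 : L) else 0)).Local v × (cmDatum L 1 (Matrix.of fun i j : Fin 1 => if i.val + j.val + 1 = 1 then (1 : L) else 0)).Local v, BorelSpace (((cmDatum L 2 (Matrix.of fun i j : Fin 2 => if i.val + j.val + 1 = 2 then (1 : L) else 0)).Local v × (cmDatum L 1 (Matrix.of fun i j : Fin 1 => if i.val + j.val + 1 = 1 then (1 : L) else 0)).Local v) ⧸ Subgroup.centralizer ({a} : Set ((cmDatum L 2 (Matrix.of fun i j : Fin 2 => if i.val + j.val + 1 = 2 then (1 : L) else 0)).Local v × (cmDatum L 1 (Matrix.of fun i j : Fin 1 => if i.val + j.val + 1 = 1 then (1 : L) else 0)).Local v)))]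
  (νH : Measure ((cmDatum L 2 (Matrix.of fun i j : Fin 2 => if i.val + j.val + 1 = 2 then (1 : L) else 0)).Local v × (cmDatum L 1 (Matrix.of fun i j : Fin 1 => if i.val + j.val + 1 = 1 then (1 : L) else 0)).Local v)) [νH.IsHaarMeasure] [νH.IsMulRightInvariant]

omit [IsCMField L] in
/-- `2 ≤ q_v`. [cite: Rogawski1990, §4.9 p. 54] -/
private theorem two_le_natCard_quotient_lvl : 2 ≤ Nat.card (𝓞 ↥(maximalRealSubfield L) ⧸ v.asIdeal) := by
  classical
  haveI : Finite (𝓞 ↥(maximalRealSubfield L) ⧸ v.asIdeal) := Ideal.finiteQuotientOfFreeOfNeBot v.asIdeal v.ne_bot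
  haveI : Nontrivial (𝓞 ↥(maximalRealSubfield L) ⧸ v.asIdeal) := Ideal.Quotient.nontrivial_iff.2 v.isPrime.ne_top
  exact Finite.one_lt_card

set_option maxHeartbeats 800000 in
include hw in
/-- **THE PER-CLASS LEVEL-ONE VALUE, TYPE (2), EISENSTEIN CENTRE** (`ν_H(K_H) = 1`): `Φ(⟦γ_H⟧, f) = Σ_(k < j) q_v^k` for `f` the level-`ϖ_w` class function on `K_H`
(★ F2-H spelling, `c := ϖ_w`), `γ_H = (γ₂, γ₁)` `G`-regular of type (2) with an admissible Eisenstein centre `(a, f, e′, j)` and deep (`|tr − 2| < 1`, `|det − 1| < 1`),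
`[CompactSpace Z(γ₂)]`: ★ F2-H `classOrbitalIntegral_level_prod_eq_ncard_selfDual_level` ∘ §2.  Twin of ★ FILE C `classOrbitalIntegral_level_eq_sum_of_not_exists_isRoot` at
`j = 1` (`h2 hint N hN` ↦ the admissible centre). [cite: Flicker1998UnitaryFL, §6 p. 97] [cite: Rogawski1990, §4.9 Prop. 4.9.1 (b) p. 55] -/
theorem classOrbitalIntegral_levelOne_eq_sum_of_not_exists_isRoot_affine (hunr : Algebra.IsUnramifiedIn (𝓞 L) v.asIdeal)
    {mH : OrbitalMeasureFamily ((cmDatum L 2 (Matrix.of fun i j : Fin 2 => if i.val + j.val + 1 = 2 then (1 : L) else 0)).Local v × (cmDatum L 1 (Matrix.of fun i j : Fin 1 => if i.val + j.val + 1 = 1 then (1 : L) else 0)).Local v)} (hmH : mH.IsCanonical (IsLocalGRegular L v) νH) (hνH : νH ((((cmLocalIntegralLevel L 2 (Matrix.of fun i j : Fin 2 => if i.val + j.val + 1 = 2 then (1 : L) else 0) v).prod (cmLocalIntegralLevel L 1 (Matrix.of fun i j : Fin 1 => if i.val + j.val + 1 = 1 then (1 : L) else 0) v)) : Subgroup ((cmDatum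 L 2 (Matrix.of fun i j : Fin 2 => if i.val + j.val + 1 = 2 then (1 : L) else 0)).Local v × (cmDatum L 1 (Matrix.of fun i j : Fin 1 => if i.val + j.val + 1 = 1 then (1 : L) else 0)).Local v)) : Set ((cmDatum L 2 (Matrix.of fun i j : Fin 2 => if i.val + j.val + 1 = 2 then (1 : L) else 0)).Local v × (cmDatum L 1 (Matrix.of fun i j : Fin 1 => if i.val + j.val + 1 = 1 then (1 : L) else 0)).Local v)) = 1)
    {γH : (cmDatum L 2 (Matrix.of fun i j : Fin 2 => if i.val + j.val + 1 = 2 then (1 : L) else 0)).Local v × (cmDatum L 1 (Matrix.of fun i j : Fin 1 => if i.val + j.val + 1 = 1 then (1 : L) else 0)).Local v} (hreg : IsLocalGRegular L v γH)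
    [CompactSpace (Subgroup.centralizer ({γH.1} : Set ((cmDatum L 2 (Matrix.of fun i j : Fin 2 => if i.val + j.val + 1 = 2 then (1 : L) else 0)).Local v)))]
    (hirr : ¬ ∃ x : (w.1.adicCompletion L), ((((((γH.1.val : GL (Fin 2) (LocalRing L v)) : Matrix (Fin 2) (Fin 2) (LocalRing L v)).map (Pi.evalRingHom (fun w' : PlacesOver L v => w'.1.adicCompletion L) w)))).charpoly).IsRoot x)
    {a f e' : (w.1.adicCompletion L)} (haO : a ∈ 𝒪[(w.1.adicCompletion L)]) {j : ℕ}
    (hf : valuation (w.1.adicCompletion L) f ≤ valuation (w.1.adicCompletion L) ((toPlace v w (GaloisRepresentations.HeckeCharacter.uniformizer ↥(maximalRealSubfield L) v : v.adicCompletion ↥(maximalRealSubfield L))) ^ (j + 1)))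
    (hj : valuation (w.1.adicCompletion L) e' = valuation (w.1.adicCompletion L) ((toPlace v w (GaloisRepresentations.HeckeCharacter.uniformizer ↥(maximalRealSubfield L) v : v.adicCompletion ↥(maximalRealSubfield L))) ^ (2 * j + 1)))
    (htf : ((((γH.1.val : GL (Fin 2) (LocalRing L v)) : Matrix (Fin 2) (Fin 2) (LocalRing L v)).map (Pi.evalRingHom (fun w' : PlacesOver L v => w'.1.adicCompletion L) w))).trace - 2 * a = f) (hde : a * a - ((((γH.1.val : GL (Fin 2) (LocalRing L v)) : Matrix (Fin 2) (Fin 2) (LocalRing L v)).map (Pi.evalRingHom (fun w' : PlacesOver L v => w'.1.adicCompletion L) w))).trace * a + ((((γH.1.val : GL (Fin 2) (LocalRing L v)) : Matrix (Fin 2) (Fin 2) (LocalRing L v)).map (Pi.evalRingHom (fun w' : PlacesOver L v => w'.1.adicCompletion L) w))).det = -e')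
    (htr : valuation (w.1.adicCompletion L) (((((γH.1.val : GL (Fin 2) (LocalRing L v)) : Matrix (Fin 2) (Fin 2) (LocalRing L v)).map (Pi.evalRingHom (fun w' : PlacesOver L v => w'.1.adicCompletion L) w))).trace - 2) < 1) (hdet : valuation (w.1.adicCompletion L) (((((γH.1.val : GL (Fin 2) (LocalRing L v)) : Matrix (Fin 2) (Fin 2) (LocalRing L v)).map (Pi.evalRingHom (fun w' : PlacesOver L v => w'.1.adicCompletion L) w))).det - 1) < 1)
    (f : ((cmDatum L 2 (Matrix.of fun i j : Fin 2 => if i.val + j.val + 1 = 2 then (1 : L) else 0)).Local v × (cmDatum L 1 (Matrix.of fun i j : Fin 1 => if i.val + j.val + 1 = 1 then (1 : L) else 0)).Local v) → ℂ) (hfc : Continuous f) (hfK : Function.support f ⊆ ((((cmLocalIntegralLevel L 2 (Matrix.of fun i j : Fin 2 => if i.val + j.val + 1 = 2 then (1 : L) else 0) v).prod (cmLocalIntegralLevel L 1 (Matrix.of fun i j : Fin 1 => if i.val + j.val + 1 = 1 then (1 : L) else 0) v)) : Subgroup ((cmDatum L 2 (Matrix.of fun i j : Fin 2 => if i.val +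 j.val + 1 = 2 then (1 : L) else 0)).Local v × (cmDatum L 1 (Matrix.of fun i j : Fin 1 => if i.val + j.val + 1 = 1 then (1 : L) else 0)).Local v)) : Set ((cmDatum L 2 (Matrix.of fun i j : Fin 2 => if i.val + j.val + 1 = 2 then (1 : L) else 0)).Local v × (cmDatum L 1 (Matrix.of fun i j : Fin 1 => if i.val + j.val + 1 = 1 then (1 : L) else 0)).Local v)))
    (hfinv : ∀ k ∈ (((cmLocalIntegralLevel L 2 (Matrix.of fun i j : Fin 2 => if i.val + j.val + 1 = 2 then (1 : L) else 0) v).prod (cmLocalIntegralLevel L 1 (Matrix.of fun i j : Fin 1 => if i.val + j.val + 1 = 1 then (1 : L) else 0) v)) : Subgroup ((cmDatum L 2 (Matrix.of fun i j : Fin 2 => if i.val + j.val + 1 = 2 then (1 : L) else 0)).Local v × (cmDatum L 1 (Matrix.of fun i j : Fin 1 => if i.val + j.val + 1 = 1 then (1 : L) else 0)).Local v)), ∀ x, f (k * x * k⁻¹) = f x)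
    (hf1 : ∀ x ∈ (((cmLocalIntegralLevel L 2 (Matrix.of fun i j : Fin 2 => if i.val + j.val + 1 = 2 then (1 : L) else 0) v).prod (cmLocalIntegralLevel L 1 (Matrix.of fun i j : Fin 1 => if i.val + j.val + 1 = 1 then (1 : L) else 0) v)) : Subgroup ((cmDatum L 2 (Matrix.of fun i j : Fin 2 => if i.val + j.val + 1 = 2 then (1 : L) else 0)).Local v × (cmDatum L 1 (Matrix.of fun i j : Fin 1 => if i.val + j.val + 1 = 1 then (1 : L) else 0)).Local v)), (∀ a b, valuation (w.1.adicCompletion L) ((((((localNonsplitEquiv (IsCMField.complexConj L) (Matrix.of fun i j : Fin 2 => if i.val + j.val + 1 = 2 then (1 : L) else 0) (IsCMField.complexConj_ne_one L) w hw) (x).1 : ↥(unitaryGroupOfForm (galAdicCompletionMap (L := L) (IsCMField.complexConj L) hw) (placeForm (Matrix.of fun i j : Fin 2 => if i.val + j.val + 1 = 2 then (1 : L) else 0) w.1))) : GL (Fin 2) (w.1.adicCompletion L)) : Matrix (Fin 2) (Fin 2) (w.1.adicCompletion L)) - 1) a b) ≤ valuation (w.1.adicCompletion L) (toPlace v w (GaloisRepresentations.HeckeCharacter.uniformizer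 ↥(maximalRealSubfield L) v : v.adicCompletion ↥(maximalRealSubfield L)))) → f x = 1)
    (hf0 : ∀ x ∈ (((cmLocalIntegralLevel L 2 (Matrix.of fun i j : Fin 2 => if i.val + j.val + 1 = 2 then (1 : L) else 0) v).prod (cmLocalIntegralLevel L 1 (Matrix.of fun i j : Fin 1 => if i.val + j.val + 1 = 1 then (1 : L) else 0) v)) : Subgroup ((cmDatum L 2 (Matrix.of fun i j : Fin 2 => if i.val + j.val + 1 = 2 then (1 : L) else 0)).Local v × (cmDatum L 1 (Matrix.of fun i j : Fin 1 => if i.val + j.val + 1 = 1 then (1 : L) else 0)).Local v)), ¬ (∀ a b, valuation (w.1.adicCompletion L) ((((((localNonsplitEquiv (IsCMField.complexConj L) (Matrix.of fun i j : Fin 2 => if i.val + j.val + 1 = 2 then (1 : L) else 0) (IsCMField.complexConj_ne_one L) w hw) (x).1 : ↥(unitaryGroupOfForm (galAdicCompletionMap (L := L) (IsCMField.complexConj L) hw) (placeForm (Matrix.of fun i j : Fin 2 => if i.val + j.val + 1 = 2 then (1 : L) else 0) w.1))) : GL (Fin 2) (w.1.adicCompletion L)) : Matrix (Fin 2) (Fin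 2) (w.1.adicCompletion L)) - 1) a b) ≤ valuation (w.1.adicCompletion L) (toPlace v w (GaloisRepresentations.HeckeCharacter.uniformizer ↥(maximalRealSubfield L) v : v.adicCompletion ↥(maximalRealSubfield L)))) → f x = 0) :
    classOrbitalIntegral mH f (ConjClasses.mk γH) = ((∑ k ∈ range j, Nat.card (𝓞 ↥(maximalRealSubfield L) ⧸ v.asIdeal) ^ k : ℕ) : ℂ) := by
  have hϖv := Liu2021.LemD1IndexedNonVacuityInertCofinite.valued_toPlace_uniformizer_of_isUnramifiedIn L v hunr w
  have hϖ := isUniformizingElement_of_v_eq hϖv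
  have key := classOrbitalIntegral_level_prod_eq_ncard_selfDual_level L v νH hmH hνH γH hreg w hw hunr hϖ.ne_zero hϖ.valuation_lt_one f hfc hfK hfinv hf1 hf0
  refine key.trans ?_
  rw [ncard_selfDualStable_levelOne_antidiagTwo_eq_sum_of_not_exists_isRoot_admissible L v w hw hunr γH hirr haO hf hj htf hde htr hdet]

set_option maxHeartbeats 800000 in
include hw in
/-- **THE TYPE-(2) LEVEL-ONE VALUE FOR ANY HAAR MEASURE, EISENSTEIN CENTRE: `Φ^st(γ_H, f) = ν_H(K_H) · phiHtwo q (j − 1)`** (`1 ≤ j`) — one class in the stable class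
(★ `…_of_not_exists_isRoot`), the Haar measure normalised on `K_H` (★ FILE A `exists_normalised`), the per-class value and `Σ_(k < j) q^k = phiHtwo q (j − 1)` (`geom_sum_eq`).
Twin of ★ FILE C `stableOrbitalIntegralRel_level_eq_mul_phiHtwo_of_not_exists_isRoot` at level one; `f` = the level-`ϖ_w` class function on `K_H`.
[cite: Flicker1998UnitaryFL, §6 p. 97] [cite: Rogawski1990, §4.9 Prop. 4.9.1 (b) p. 55; §4.3 (4.3.1) p. 43] -/
theorem stableOrbitalIntegralRel_levelOne_eq_mul_phiHtwo_of_not_exists_isRoot_affine (hunr : Algebra.IsUnramifiedIn (𝓞 L) v.asIdeal)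
    {mH : OrbitalMeasureFamily ((cmDatum L 2 (Matrix.of fun i j : Fin 2 => if i.val + j.val + 1 = 2 then (1 : L) else 0)).Local v × (cmDatum L 1 (Matrix.of fun i j : Fin 1 => if i.val + j.val + 1 = 1 then (1 : L) else 0)).Local v)} (hmH : mH.IsCanonical (IsLocalGRegular L v) νH)
    {γH : (cmDatum L 2 (Matrix.of fun i j : Fin 2 => if i.val + j.val + 1 = 2 then (1 : L) else 0)).Local v × (cmDatum L 1 (Matrix.of fun i j : Fin 1 => if i.val + j.val + 1 = 1 then (1 : L) else 0)).Local v} (hreg : IsLocalGRegular L v γH)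
    [CompactSpace (Subgroup.centralizer ({γH.1} : Set ((cmDatum L 2 (Matrix.of fun i j : Fin 2 => if i.val + j.val + 1 = 2 then (1 : L) else 0)).Local v)))]
    (hirr : ¬ ∃ x : (w.1.adicCompletion L), ((((((γH.1.val : GL (Fin 2) (LocalRing L v)) : Matrix (Fin 2) (Fin 2) (LocalRing L v)).map (Pi.evalRingHom (fun w' : PlacesOver L v => w'.1.adicCompletion L) w)))).charpoly).IsRoot x)
    {a f e' : (w.1.adicCompletion L)} (haO : a ∈ 𝒪[(w.1.adicCompletion L)]) {j : ℕ}
    (hf : valuation (w.1.adicCompletion L) f ≤ valuation (w.1.adicCompletion L) ((toPlace v w (GaloisRepresentations.HeckeCharacter.uniformizer ↥(maximalRealSubfield L) v : v.adicCompletion ↥(maximalRealSubfield L))) ^ (j + 1)))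
    (hj : valuation (w.1.adicCompletion L) e' = valuation (w.1.adicCompletion L) ((toPlace v w (GaloisRepresentations.HeckeCharacter.uniformizer ↥(maximalRealSubfield L) v : v.adicCompletion ↥(maximalRealSubfield L))) ^ (2 * j + 1)))
    (htf : ((((γH.1.val : GL (Fin 2) (LocalRing L v)) : Matrix (Fin 2) (Fin 2) (LocalRing L v)).map (Pi.evalRingHom (fun w' : PlacesOver L v => w'.1.adicCompletion L) w))).trace - 2 * a = f) (hde : a * a - ((((γH.1.val : GL (Fin 2) (LocalRing L v)) : Matrix (Fin 2) (Fin 2) (LocalRing L v)).map (Pi.evalRingHom (fun w' : PlacesOver L v => w'.1.adicCompletion L) w))).trace * a + ((((γH.1.val : GL (Fin 2) (LocalRing L v)) : Matrix (Fin 2) (Fin 2) (LocalRing L v)).map (Pi.evalRingHom (fun w' : PlacesOver L v => w'.1.adicCompletion L) w))).det = -e')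
    (hj1 : 1 ≤ j)
    (htr : valuation (w.1.adicCompletion L) (((((γH.1.val : GL (Fin 2) (LocalRing L v)) : Matrix (Fin 2) (Fin 2) (LocalRing L v)).map (Pi.evalRingHom (fun w' : PlacesOver L v => w'.1.adicCompletion L) w))).trace - 2) < 1) (hdet : valuation (w.1.adicCompletion L) (((((γH.1.val : GL (Fin 2) (LocalRing L v)) : Matrix (Fin 2) (Fin 2) (LocalRing L v)).map (Pi.evalRingHom (fun w' : PlacesOver L v => w'.1.adicCompletion L) w))).det - 1) < 1)
    (f : ((cmDatum L 2 (Matrix.of fun i j : Fin 2 => if i.val + j.val + 1 = 2 then (1 : L) else 0)).Local v × (cmDatum L 1 (Matrix.of fun i j : Fin 1 => if i.val + j.val + 1 = 1 then (1 : L) else 0)).Local v) → ℂ) (hfc : Continuous f) (hfK : Function.support f ⊆ ((((cmLocalIntegralLevel L 2 (Matrix.of fun i j : Fin 2 => if i.val + j.val + 1 = 2 then (1 : L) else 0) v).prod (cmLocalIntegralLevel L 1 (Matrix.of fun i j : Fin 1 => if i.val + j.val + 1 = 1 then (1 : L) else 0) v)) : Subgroup ((cmDatum L 2 (Matrix.of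 fun i j : Fin 2 => if i.val + j.val + 1 = 2 then (1 : L) else 0)).Local v × (cmDatum L 1 (Matrix.of fun i j : Fin 1 => if i.val + j.val + 1 = 1 then (1 : L) else 0)).Local v)) : Set ((cmDatum L 2 (Matrix.of fun i j : Fin 2 => if i.val + j.val + 1 = 2 then (1 : L) else 0)).Local v × (cmDatum L 1 (Matrix.of fun i j : Fin 1 => if i.val + j.val + 1 = 1 then (1 : L) else 0)).Local v)))
    (hfinv : ∀ k ∈ (((cmLocalIntegralLevel L 2 (Matrix.of fun i j : Fin 2 => if i.val + j.val + 1 = 2 then (1 : L) else 0) v).prod (cmLocalIntegralLevel L 1 (Matrix.of fun i j : Fin 1 => if i.val + j.val + 1 = 1 then (1 : L) else 0) v)) : Subgroup ((cmDatum L 2 (Matrix.of fun i j : Fin 2 => if i.val + j.val + 1 = 2 then (1 : L) else 0)).Local v × (cmDatum L 1 (Matrix.of fun i j : Fin 1 => if i.val + j.val + 1 = 1 then (1 : L) else 0)).Local v)), ∀ x, f (k * x * k⁻¹) = f x)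
    (hf1 : ∀ x ∈ (((cmLocalIntegralLevel L 2 (Matrix.of fun i j : Fin 2 => if i.val + j.val + 1 = 2 then (1 : L) else 0) v).prod (cmLocalIntegralLevel L 1 (Matrix.of fun i j : Fin 1 => if i.val + j.val + 1 = 1 then (1 : L) else 0) v)) : Subgroup ((cmDatum L 2 (Matrix.of fun i j : Fin 2 => if i.val + j.val + 1 = 2 then (1 : L) else 0)).Local v × (cmDatum L 1 (Matrix.of fun i j : Fin 1 => if i.val + j.val + 1 = 1 then (1 : L) else 0)).Local v)), (∀ a b, valuation (w.1.adicCompletion L) ((((((localNonsplitEquiv (IsCMField.complexConj L) (Matrix.of fun i j : Fin 2 => if i.val + j.val + 1 = 2 then (1 : L) else 0) (IsCMField.complexConj_ne_one L) w hw) (x).1 : ↥(unitaryGroupOfForm (galAdicCompletionMap (L := L) (IsCMField.complexConj L) hw) (placeForm (Matrix.of fun i j : Fin 2 => if i.val + j.val + 1 = 2 then (1 : L) else 0) w.1))) : GL (Fin 2) (w.1.adicCompletion L)) : Matrix (Fin 2) (Fin 2) (w.1.adicCompletion L)) - 1) a b) ≤ valuation (w.1.adicCompletion L) (toPlace v w (GaloisRepresentations.HeckeCharacter.uniformizer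 ↥(maximalRealSubfield L) v : v.adicCompletion ↥(maximalRealSubfield L)))) → f x = 1)
    (hf0 : ∀ x ∈ (((cmLocalIntegralLevel L 2 (Matrix.of fun i j : Fin 2 => if i.val + j.val + 1 = 2 then (1 : L) else 0) v).prod (cmLocalIntegralLevel L 1 (Matrix.of fun i j : Fin 1 => if i.val + j.val + 1 = 1 then (1 : L) else 0) v)) : Subgroup ((cmDatum L 2 (Matrix.of fun i j : Fin 2 => if i.val + j.val + 1 = 2 then (1 : L) else 0)).Local v × (cmDatum L 1 (Matrix.of fun i j : Fin 1 => if i.val + j.val + 1 = 1 then (1 : L) else 0)).Local v)), ¬ (∀ a b, valuation (w.1.adicCompletion L) ((((((localNonsplitEquiv (IsCMField.complexConj L) (Matrix.of fun i j : Fin 2 => if i.val + j.val + 1 = 2 then (1 : L) else 0) (IsCMField.complexConj_ne_one L) w hw) (x).1 : ↥(unitaryGroupOfForm (galAdicCompletionMap (L := L) (IsCMField.complexConj L) hw) (placeForm (Matrix.of fun i j : Fin 2 => if i.val + j.val + 1 = 2 then (1 : L) else 0) w.1))) : GL (Fin 2) (w.1.adicCompletion L)) : Matrix (Fin 2) (Fin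 2) (w.1.adicCompletion L)) - 1) a b) ≤ valuation (w.1.adicCompletion L) (toPlace v w (GaloisRepresentations.HeckeCharacter.uniformizer ↥(maximalRealSubfield L) v : v.adicCompletion ↥(maximalRealSubfield L)))) → f x = 0) :
    stableOrbitalIntegralRel (IsLocalStablyConjH L v) mH f γH = (νH.real ((((cmLocalIntegralLevel L 2 (Matrix.of fun i j : Fin 2 => if i.val + j.val + 1 = 2 then (1 : L) else 0) v).prod (cmLocalIntegralLevel L 1 (Matrix.of fun i j : Fin 1 => if i.val + j.val + 1 = 1 then (1 : L) else 0) v)) : Subgroup ((cmDatum L 2 (Matrix.of fun i j : Fin 2 => if i.val + j.val + 1 = 2 then (1 : L) else 0)).Local v × (cmDatum L 1 (Matrix.of fun i j : Fin 1 => if i.val + j.val + 1 = 1 then (1 : L) else 0)).Local v)) : Set ((cmDatum L 2 (Matrix.of fun i j : Fin 2 => if i.val + j.val + 1 = 2 then (1 : L) else 0)).Local v × (cmDatum L 1 (Matrix.of fun i j : Fin 1 => if i.val + j.val + 1 = 1 then (1 : L) else 0)).Local v)) : ℂ) * ((Flicker1998.phiHtwo (Ideal.absNorm v.asIdeal) (j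 - 1) : ℚ) : ℂ) := by
  obtain ⟨hKc, hKi⟩ := isCompact_and_interior_nonempty_prod_cmLocalIntegralLevel L v
  obtain ⟨ν₁, hν₁, hν₁', m₁, hm₁, h1, -, hst⟩ := hmH.exists_normalised hKc hKi
  rw [hst]
  congr 1
  rw [stableOrbitalIntegralRel_eq_classOrbitalIntegral_of_not_exists_isRoot L v w hw m₁ f hirr,
    classOrbitalIntegral_levelOne_eq_sum_of_not_exists_isRoot_affine L v w hw ν₁ hunr hm₁ h1 hreg hirr haO hf hj htf hde htr hdet f hfc hfK hfinv hf1 hf0,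
    Flicker1998.phiHtwo, Ideal.absNorm_apply, Submodule.cardQuot_apply]
  have hq2 := two_le_natCard_quotient_lvl L v
  have hq1 : ((Nat.card (𝓞 ↥(maximalRealSubfield L) ⧸ v.asIdeal) : ℚ)) ≠ 1 := by exact_mod_cast (show Nat.card (𝓞 ↥(maximalRealSubfield L) ⧸ v.asIdeal) ≠ 1 by omega)
  rw [show j - 1 + 1 = j by omega, ← geom_sum_eq hq1 j]
  push_cast
  rfl

set_option maxHeartbeats 800000 in
include hw in
/-- **THE TYPE-(2) UNIT VALUE FOR ANY HAAR MEASURE, EISENSTEIN CENTRE: `Φ^st(γ_H, 1_{K_H}) = ν_H(K_H) · phiHtwo q j`** — ★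
`classOrbitalIntegral_indicator_eq_phiHtwo_of_not_exists_isRoot_affine` (`ν_H(K_H) = 1`) with one class (★ `…_of_not_exists_isRoot`) and ★ FILE A `exists_normalised`.
Twin of ★ FILE C `stableOrbitalIntegralRel_indicator_eq_mul_phiHtwo_of_not_exists_isRoot` (`h2 hint N hN` ↦ the admissible centre).
[cite: Flicker1998UnitaryFL, §6 p. 97] [cite: Rogawski1990, §4.9 Prop. 4.9.1 (b) p. 55; §4.3 (4.3.1) p. 43] -/
theorem stableOrbitalIntegralRel_indicator_eq_mul_phiHtwo_of_not_exists_isRoot_affine (hunr : Algebra.IsUnramifiedIn (𝓞 L) v.asIdeal)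
    {mH : OrbitalMeasureFamily ((cmDatum L 2 (Matrix.of fun i j : Fin 2 => if i.val + j.val + 1 = 2 then (1 : L) else 0)).Local v × (cmDatum L 1 (Matrix.of fun i j : Fin 1 => if i.val + j.val + 1 = 1 then (1 : L) else 0)).Local v)} (hmH : mH.IsCanonical (IsLocalGRegular L v) νH)
    {γH : (cmDatum L 2 (Matrix.of fun i j : Fin 2 => if i.val + j.val + 1 = 2 then (1 : L) else 0)).Local v × (cmDatum L 1 (Matrix.of fun i j : Fin 1 => if i.val + j.val + 1 = 1 then (1 : L) else 0)).Local v} (hreg : IsLocalGRegular L v γH)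
    [CompactSpace (Subgroup.centralizer ({γH.1} : Set ((cmDatum L 2 (Matrix.of fun i j : Fin 2 => if i.val + j.val + 1 = 2 then (1 : L) else 0)).Local v)))]
    (hirr : ¬ ∃ x : (w.1.adicCompletion L), ((((((γH.1.val : GL (Fin 2) (LocalRing L v)) : Matrix (Fin 2) (Fin 2) (LocalRing L v)).map (Pi.evalRingHom (fun w' : PlacesOver L v => w'.1.adicCompletion L) w)))).charpoly).IsRoot x)
    {a f e' : (w.1.adicCompletion L)} (haO : a ∈ 𝒪[(w.1.adicCompletion L)]) {j : ℕ}
    (hf : valuation (w.1.adicCompletion L) f ≤ valuation (w.1.adicCompletion L) ((toPlace v w (GaloisRepresentations.HeckeCharacter.uniformizer ↥(maximalRealSubfield L) v : v.adicCompletion ↥(maximalRealSubfield L))) ^ (j + 1)))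
    (hj : valuation (w.1.adicCompletion L) e' = valuation (w.1.adicCompletion L) ((toPlace v w (GaloisRepresentations.HeckeCharacter.uniformizer ↥(maximalRealSubfield L) v : v.adicCompletion ↥(maximalRealSubfield L))) ^ (2 * j + 1)))
    (htf : ((((γH.1.val : GL (Fin 2) (LocalRing L v)) : Matrix (Fin 2) (Fin 2) (LocalRing L v)).map (Pi.evalRingHom (fun w' : PlacesOver L v => w'.1.adicCompletion L) w))).trace - 2 * a = f) (hde : a * a - ((((γH.1.val : GL (Fin 2) (LocalRing L v)) : Matrix (Fin 2) (Fin 2) (LocalRing L v)).map (Pi.evalRingHom (fun w' : PlacesOver L v => w'.1.adicCompletion L) w))).trace * a + ((((γH.1.val : GL (Fin 2) (LocalRing L v)) : Matrix (Fin 2) (Fin 2) (LocalRing L v)).map (Pi.evalRingHom (fun w' : PlacesOver L v => w'.1.adicCompletion L) w))).det = -e') :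
    stableOrbitalIntegralRel (IsLocalStablyConjH L v) mH (((((cmLocalIntegralLevel L 2 (Matrix.of fun i j : Fin 2 => if i.val + j.val + 1 = 2 then (1 : L) else 0) v).prod (cmLocalIntegralLevel L 1 (Matrix.of fun i j : Fin 1 => if i.val + j.val + 1 = 1 then (1 : L) else 0) v)) : Subgroup ((cmDatum L 2 (Matrix.of fun i j : Fin 2 => if i.val + j.val + 1 = 2 then (1 : L) else 0)).Local v × (cmDatum L 1 (Matrix.of fun i j : Fin 1 => if i.val + j.val + 1 = 1 then (1 : L) else 0)).Local v)) : Set ((cmDatum L 2 (Matrix.of fun i j : Fin 2 => if i.val + j.val + 1 = 2 then (1 : L) else 0)).Local v × (cmDatum L 1 (Matrix.of fun i j : Fin 1 => if i.val + j.val + 1 = 1 then (1 : L) else 0)).Local v)).indicator fun _ => (1 : ℂ)) γH = (νH.real ((((cmLocalIntegralLevel L 2 (Matrix.of fun i j : Fin 2 => if i.val + j.val + 1 = 2 then (1 : L) else 0) v).prod (cmLocalIntegralLevel L 1 (Matrix.of fun i j : Fin 1 => if i.val + j.val + 1 = 1 then (1 : L) else 0) v)) : Subgroup ((cmDatum L 2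 (Matrix.of fun i j : Fin 2 => if i.val + j.val + 1 = 2 then (1 : L) else 0)).Local v × (cmDatum L 1 (Matrix.of fun i j : Fin 1 => if i.val + j.val + 1 = 1 then (1 : L) else 0)).Local v)) : Set ((cmDatum L 2 (Matrix.of fun i j : Fin 2 => if i.val + j.val + 1 = 2 then (1 : L) else 0)).Local v × (cmDatum L 1 (Matrix.of fun i j : Fin 1 => if i.val + j.val + 1 = 1 then (1 : L) else 0)).Local v)) : ℂ) * ((Flicker1998.phiHtwo (Ideal.absNorm v.asIdeal) j : ℚ) : ℂ) := by
  obtain ⟨hKc, hKi⟩ := isCompact_and_interior_nonempty_prod_cmLocalIntegralLevel L v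
  obtain ⟨ν₁, hν₁, hν₁', m₁, hm₁, h1, -, hst⟩ := hmH.exists_normalised hKc hKi
  rw [hst, stableOrbitalIntegralRel_eq_classOrbitalIntegral_of_not_exists_isRoot L v w hw m₁ _ hirr,
    classOrbitalIntegral_indicator_eq_phiHtwo_of_not_exists_isRoot_affine L v w hw ν₁ hunr hm₁ h1 hreg hirr haO hf hj htf hde]

end Head

end Literature.NumberTheory.Automorphic.UnitaryGroup

end
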